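import Mathlib
import Literature.NumberTheory.LFunctions.TaoLogChowlaMoebiusOfLiouville
import HarnessLib

/-!
# Route `IsogenyRedei` — support item `SliceFrame` (stmt-Parity-14953): the squarefree sieve

Step (i-b) of `SliceFrame`, pointwise in `y`: for a fixed cofactor modulus `e ≥ 1` the sum
`A_e(y) = ∑_{n ≤ y, e ∣ n²+1} μ((n²+1)/e)` is rewritten, with `m = (n²+1)/e`,
`μ(m) = (−1)^{ω(m)}·1_{□-free}(m)`, `1_{□-free}(m) = ∑_{r² ∣ m} μ(r)`
(`Literature.NumberTheory.LFunctions.sqfreeInd_eq_sum_moebius`) and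
`(−1)^{ω(m)} = (−1)^{ω(n²+1)}·(−1)^{#{p ∣ e : p·e ∤ n²+1}}`, as
`∑_r μ(r) ∑_{n ≤ y} W_{e,r}(n) (−1)^{ω(n²+1)}` with a weight `W_{e,r}` of modulus `≤ 1` and period
`e²r²` (`cofactor_sum_eq_sieve`, `weight_modEq`).  The range `r ≤ R` is bounded by the parity
input along progressions of modulus `e²r²` (periodic twists: hypothesis `htwist` =
`abs_sum_mul_le_sum_abs_progressions` of `IsogenyRedeiSliceFrameParity`), the range `R < r ≤ Z` by
the root-class count (hypothesis `hC₂` = `exists_card_sq_dvd_le`) and `∑_{r>R} r^{-3/2} ≤ 2/√R`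
(hypothesis `htail` = `sum_Ioc_one_div_mul_sqrt_le`), and the range `r > Z` by the negative Pell
count (hypothesis `hlarge` = `sum_card_sq_dvd_large_le card_negPell_le`), all of
`IsogenyRedeiSliceFrameCounting` / `…Pell`: `abs_cofactor_sum_le`.  These inputs are hypotheses
only so that this file elaborates against Mathlib/Literature oleans alone; the frame file
discharges them.
-/

namespace Summit.Parity.BatemanHorn.Theorems.SliceFrame

open Finset
open Literature.NumberTheory.LFunctions (sqfreeInd sqfreeInd_eq_sum_moebius)

open scoped ArithmeticFunction.Moebius

/-! ### Pointwise identities -/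

/-- `(−1)^{ω(e m)} = (−1)^{ω(m)} · (−1)^{#{p ∣ e prime : p ∤ m}}` for `e, m ≠ 0`. [folklore] -/
theorem neg_one_pow_card_primeFactors_mul {e m : ℕ} (he : e ≠ 0) (hm : m ≠ 0) :
    (-1 : ℝ) ^ (e * m).primeFactors.card
      = (-1 : ℝ) ^ m.primeFactors.card
        * (-1) ^ (e.primeFactors.filter (fun p : ℕ => ¬ p ∣ m)).card := by
  classical
  rw [Nat.primeFactors_mul he hm, ← pow_add]
  congr 1
  have hsd : e.primeFactors \ m.primeFactors = e.primeFactors.filter (fun p : ℕ => ¬ p ∣ m) := by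
    ext p
    rw [Finset.mem_sdiff, Finset.mem_filter, Nat.mem_primeFactors, Nat.mem_primeFactors]
    constructor
    · rintro ⟨⟨hp, hpe, he0⟩, h2⟩
      exact ⟨⟨hp, hpe, he0⟩, fun hpm => h2 ⟨hp, hpm, hm⟩⟩
    · rintro ⟨⟨hp, hpe, he0⟩, h2⟩
      exact ⟨⟨hp, hpe, he0⟩, fun h => h2 h.2.1⟩
  rw [← hsd, ← Finset.card_sdiff_add_card, add_comm]

/-- `μ(m) = (−1)^{ω(m)} · 1_{□-free}(m)` (as real numbers). [folklore] -/
theorem moebius_eq_sign_mul_sqfreeInd (m : ℕ) :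
    (μ m : ℝ) = (-1 : ℝ) ^ m.primeFactors.card * sqfreeInd m := by
  unfold Literature.NumberTheory.LFunctions.sqfreeInd
  by_cases hm : Squarefree m
  · rw [if_pos hm, mul_one, ArithmeticFunction.moebius_apply_of_squarefree hm]
    have h0 : m ≠ 0 := hm.ne_zero
    have hΩ : ArithmeticFunction.cardFactors m = m.primeFactors.card := by
      rw [← (ArithmeticFunction.cardDistinctFactors_eq_cardFactors_iff_squarefree h0).mpr hm,
        ArithmeticFunction.cardDistinctFactors_apply, ← List.card_toFinset, Nat.toFinset_factors]
    rw [hΩ]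
    push_cast
    ring
  · rw [if_neg hm, mul_zero, ArithmeticFunction.moebius_eq_zero_of_not_squarefree hm]
    simp

/-- **The sieve, pointwise.** For `e ≥ 1` and `n² + 1 ≤ N_b`:
`[e ∣ n²+1]·μ((n²+1)/e) = ∑_{r ≤ N_b} μ(r) · W_{e,r}(n) · (−1)^{ω(n²+1)}` with
`W_{e,r}(n) = [e r² ∣ n²+1]·(−1)^{#{p ∣ e : p e ∤ n²+1}}`. [folklore] -/
theorem moebius_cofactor_pointwise {e Nb n : ℕ} (he : 1 ≤ e) (hn : n ^ 2 + 1 ≤ Nb) :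
    (if e ∣ n ^ 2 + 1 then (μ ((n ^ 2 + 1) / e) : ℝ) else 0)
      = ∑ r ∈ Finset.Icc 1 Nb, (μ r : ℝ) *
          ((if e * r ^ 2 ∣ n ^ 2 + 1 then
              (-1 : ℝ) ^ (e.primeFactors.filter (fun p : ℕ => ¬ p * e ∣ n ^ 2 + 1)).card else 0)
            * (-1 : ℝ) ^ (n ^ 2 + 1).primeFactors.card) := by
  classical
  have he0 : e ≠ 0 := by omega
  by_cases hediv : e ∣ n ^ 2 + 1
  · set m := (n ^ 2 + 1) / e with hm_def
    have hem : e * m = n ^ 2 + 1 := Nat.mul_div_cancel' hediv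
    have hm0 : 0 < m := by
      rcases Nat.eq_zero_or_pos m with h | h
      · rw [h, mul_zero] at hem; omega
      · exact h
    have hmNb : m ≤ Nb := (Nat.div_le_self _ _).trans hn
    rw [if_pos hediv, moebius_eq_sign_mul_sqfreeInd m, sqfreeInd_eq_sum_moebius hm0 hmNb]
    simp only [Finset.sum_filter, Finset.mul_sum]
    refine Finset.sum_congr rfl (fun r _ => ?_)
    have hiff : r ^ 2 ∣ m ↔ e * r ^ 2 ∣ n ^ 2 + 1 := Nat.dvd_div_iff_mul_dvd hediv
    by_cases hr : r ^ 2 ∣ m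
    · rw [if_pos hr, if_pos (hiff.mp hr)]
      -- the sign bookkeeping
      have hsign : (-1 : ℝ) ^ (n ^ 2 + 1).primeFactors.card
          = (-1 : ℝ) ^ m.primeFactors.card
            * (-1) ^ (e.primeFactors.filter (fun p : ℕ => ¬ p * e ∣ n ^ 2 + 1)).card := by
        have hfilt : e.primeFactors.filter (fun p : ℕ => ¬ p ∣ m)
            = e.primeFactors.filter (fun p : ℕ => ¬ p * e ∣ n ^ 2 + 1) := by
          refine Finset.filter_congr (fun p _ => ?_)
          rw [← hem, mul_comm e m]
          exact not_congr (mul_dvd_mul_iff_right he0).symm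
        rw [← hfilt, ← neg_one_pow_card_primeFactors_mul he0 hm0.ne', hem]
      rw [hsign]
      have hsq : ((-1 : ℝ) ^ (e.primeFactors.filter
          (fun p : ℕ => ¬ p * e ∣ n ^ 2 + 1)).card) ^ 2 = 1 := by
        rw [← pow_mul, mul_comm, pow_mul, neg_one_sq, one_pow]
      linear_combination -((-1 : ℝ) ^ m.primeFactors.card * (μ r : ℝ)) * hsq
    · rw [if_neg hr, if_neg (fun h => hr (hiff.mpr h))]
      ring
  · rw [if_neg hediv]
    symm
    refine Finset.sum_eq_zero (fun r _ => ?_)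
    have : ¬ e * r ^ 2 ∣ n ^ 2 + 1 := fun h => hediv (dvd_trans (dvd_mul_right e _) h)
    rw [if_neg this]
    ring

/-- **The sieve identity.** For `e ≥ 1` and `y² + 1 ≤ N_b`,
`A_e(y) = ∑_{n ≤ y, e ∣ n²+1} μ((n²+1)/e) = ∑_{r ≤ N_b} μ(r) ∑_{n ≤ y} W_{e,r}(n)(−1)^{ω(n²+1)}`.
[folklore] -/
theorem cofactor_sum_eq_sieve {e y Nb : ℕ} (he : 1 ≤ e) (hNb : y ^ 2 + 1 ≤ Nb) :
    ∑ n ∈ (Finset.Icc 1 y).filter (fun n : ℕ => e ∣ n ^ 2 + 1), (μ ((n ^ 2 + 1) / e) : ℝ)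
      = ∑ r ∈ Finset.Icc 1 Nb, (μ r : ℝ) * ∑ n ∈ Finset.Icc 1 y,
          (if e * r ^ 2 ∣ n ^ 2 + 1 then
              (-1 : ℝ) ^ (e.primeFactors.filter (fun p : ℕ => ¬ p * e ∣ n ^ 2 + 1)).card else 0)
            * (-1 : ℝ) ^ (n ^ 2 + 1).primeFactors.card := by
  rw [Finset.sum_filter]
  simp_rw [Finset.mul_sum]
  rw [Finset.sum_comm]
  refine Finset.sum_congr rfl (fun n hn => ?_)
  have hny : n ≤ y := (Finset.mem_Icc.mp hn).2
  have hnNb : n ^ 2 + 1 ≤ Nb := le_trans (by nlinarith) hNb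
  exact moebius_cofactor_pointwise he hnNb

/-- The weight `W_{e,r}` is periodic modulo `e² r²`. [folklore] -/
theorem weight_modEq {e r n n' : ℕ} (h : n ≡ n' [MOD e ^ 2 * r ^ 2]) :
    (if e * r ^ 2 ∣ n ^ 2 + 1 then
        (-1 : ℝ) ^ (e.primeFactors.filter (fun p : ℕ => ¬ p * e ∣ n ^ 2 + 1)).card else 0)
      = (if e * r ^ 2 ∣ n' ^ 2 + 1 then
        (-1 : ℝ) ^ (e.primeFactors.filter (fun p : ℕ => ¬ p * e ∣ n' ^ 2 + 1)).card else 0) := by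
  have hN : n ^ 2 + 1 ≡ n' ^ 2 + 1 [MOD e ^ 2 * r ^ 2] := (h.pow 2).add_right 1
  have h1 : e * r ^ 2 ∣ n ^ 2 + 1 ↔ e * r ^ 2 ∣ n' ^ 2 + 1 :=
    hN.dvd_iff ⟨e, by ring⟩
  have h2 : ∀ p ∈ e.primeFactors, (¬ p * e ∣ n ^ 2 + 1 ↔ ¬ p * e ∣ n' ^ 2 + 1) := by
    intro p hp
    obtain ⟨k, hk⟩ := Nat.dvd_of_mem_primeFactors hp
    refine not_congr (hN.dvd_iff ⟨k * r ^ 2, ?_⟩)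
    rw [hk]; ring
  rw [Finset.filter_congr h2]
  simp only [h1]

/-- The weight `W_{e,r}` has modulus at most one. [folklore] -/
theorem abs_weight_le_one (e r n : ℕ) :
    |(if e * r ^ 2 ∣ n ^ 2 + 1 then
        (-1 : ℝ) ^ (e.primeFactors.filter (fun p : ℕ => ¬ p * e ∣ n ^ 2 + 1)).card else 0)| ≤ 1 := by
  split_ifs
  · rw [abs_pow, abs_neg, abs_one, one_pow]
  · simp

/-! ### The pointwise sieve bound -/

/-- **The squarefree sieve with rates, pointwise.** For `e, y, R ≥ 1`, `Z ≥ 1`, a root-class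
constant `C₂` as in `exists_card_sq_dvd_le`, and a bound `B` for the parity sums
`∑_{n ≤ y, n ≡ c (Q)} (−1)^{ω(n²+1)}` valid for all moduli `Q ≤ e²R²`:
`|A_e(y)| ≤ R·e²R²·B + 2C₂(y+1)/√R + C₂ Z√Z + ((y²+1)/Z²)(⌊log₃ y⌋ + 1)`.  The hypotheses
`htwist`, `htail`, `hlarge` are the tree lemmas `abs_sum_mul_le_sum_abs_progressions`,
`sum_Ioc_one_div_mul_sqrt_le`, `sum_card_sq_dvd_large_le card_negPell_le` verbatim. [folklore] -/
theorem abs_cofactor_sum_le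
    (htwist : ∀ (F w : ℕ → ℝ) (Q : ℕ), 0 < Q → (∀ n n' : ℕ, n ≡ n' [MOD Q] → w n = w n') →
      (∀ n, |w n| ≤ 1) → ∀ y : ℕ, |∑ n ∈ Finset.Icc 1 y, w n * F n|
        ≤ ∑ c ∈ Finset.range Q, |∑ n ∈ (Finset.Icc 1 y).filter (fun n : ℕ => n ≡ c [MOD Q]), F n|)
    (htail : ∀ R : ℕ, 1 ≤ R → ∀ N : ℕ,
      ∑ r ∈ Finset.Ioc R N, 1 / ((r : ℝ) * Real.sqrt r) ≤ 2 / Real.sqrt R)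
    (hlarge : ∀ (y : ℕ) (Z : ℝ), 0 < Z → ∀ T : Finset ℕ, (∀ r ∈ T, Z < (r : ℝ)) →
      ∑ r ∈ T, (((Finset.Icc 1 y).filter (fun n : ℕ => r ^ 2 ∣ n ^ 2 + 1)).card : ℝ)
        ≤ ((y : ℝ) ^ 2 + 1) / Z ^ 2 * (Nat.log 3 y + 1))
    {e y R : ℕ} (he : 1 ≤ e) (hR : 1 ≤ R) {Z B C₂ : ℝ} (hZ : 1 ≤ Z)
    (hC₂0 : 0 ≤ C₂)
    (hC₂ : ∀ r : ℕ, 1 ≤ r → ∀ y : ℕ,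
      (((Finset.Icc 1 y).filter (fun n : ℕ => r ^ 2 ∣ n ^ 2 + 1)).card : ℝ)
        ≤ C₂ * Real.sqrt r * (((y : ℝ) + 1) / (r : ℝ) ^ 2 + 1))
    (hB : ∀ Q : ℕ, 1 ≤ Q → Q ≤ e ^ 2 * R ^ 2 → ∀ c : ℕ,
      |∑ n ∈ (Finset.Icc 1 y).filter (fun n : ℕ => n ≡ c [MOD Q]),
        (-1 : ℝ) ^ (n ^ 2 + 1).primeFactors.card| ≤ B) :
    |∑ n ∈ (Finset.Icc 1 y).filter (fun n : ℕ => e ∣ n ^ 2 + 1), (μ ((n ^ 2 + 1) / e) : ℝ)|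
      ≤ (R : ℝ) * ((e : ℝ) ^ 2 * (R : ℝ) ^ 2 * B) + C₂ * ((y : ℝ) + 1) * (2 / Real.sqrt R)
        + Z * (C₂ * Real.sqrt Z) + ((y : ℝ) ^ 2 + 1) / Z ^ 2 * (Nat.log 3 y + 1) := by
  classical
  set Nb : ℕ := y ^ 2 + 1 + R with hNb_def
  have hNb : y ^ 2 + 1 ≤ Nb := Nat.le_add_right _ _
  have hRNb : R ≤ Nb := Nat.le_add_left _ _
  -- abbreviations
  set lam : ℕ → ℝ := fun n => (-1 : ℝ) ^ (n ^ 2 + 1).primeFactors.card with hlam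
  set W : ℕ → ℕ → ℝ := fun r n => if e * r ^ 2 ∣ n ^ 2 + 1 then
      (-1 : ℝ) ^ (e.primeFactors.filter (fun p : ℕ => ¬ p * e ∣ n ^ 2 + 1)).card else 0 with hW
  set I : ℕ → ℝ := fun r => ∑ n ∈ Finset.Icc 1 y, W r n * lam n with hI
  set cnt : ℕ → ℝ := fun r =>
    (((Finset.Icc 1 y).filter (fun n : ℕ => r ^ 2 ∣ n ^ 2 + 1)).card : ℝ) with hcnt
  have hid : ∑ n ∈ (Finset.Icc 1 y).filter (fun n : ℕ => e ∣ n ^ 2 + 1), (μ ((n ^ 2 + 1) / e) : ℝ)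
      = ∑ r ∈ Finset.Icc 1 Nb, (μ r : ℝ) * I r := cofactor_sum_eq_sieve he hNb
  -- (1) small `r`: the parity input on progressions modulo `e² r²`
  have hsmall : ∀ r ∈ (Finset.Icc 1 Nb).filter (fun r : ℕ => r ≤ R),
      |(μ r : ℝ) * I r| ≤ (e : ℝ) ^ 2 * (R : ℝ) ^ 2 * B := by
    intro r hr
    rw [Finset.mem_filter, Finset.mem_Icc] at hr
    obtain ⟨⟨hr1, -⟩, hrR⟩ := hr
    have hQ : 0 < e ^ 2 * r ^ 2 := by positivity
    have hQle : e ^ 2 * r ^ 2 ≤ e ^ 2 * R ^ 2 :=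
      Nat.mul_le_mul_left _ (Nat.pow_le_pow_left hrR 2)
    have htw := htwist lam (W r) (e ^ 2 * r ^ 2) hQ
      (fun n n' hnn' => weight_modEq hnn') (fun n => abs_weight_le_one e r n) y
    have hIle : |I r| ≤ ((e ^ 2 * r ^ 2 : ℕ) : ℝ) * B := by
      refine htw.trans ?_
      calc ∑ c ∈ Finset.range (e ^ 2 * r ^ 2),
            |∑ n ∈ (Finset.Icc 1 y).filter (fun n : ℕ => n ≡ c [MOD e ^ 2 * r ^ 2]), lam n|
          ≤ ∑ _c ∈ Finset.range (e ^ 2 * r ^ 2), B :=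
            Finset.sum_le_sum (fun c _ => hB (e ^ 2 * r ^ 2) hQ hQle c)
        _ = ((e ^ 2 * r ^ 2 : ℕ) : ℝ) * B := by
            rw [Finset.sum_const, Finset.card_range, nsmul_eq_mul]
    have hB0 : 0 ≤ B := (abs_nonneg _).trans (hB (e ^ 2 * r ^ 2) hQ hQle 0)
    have hμ : |(μ r : ℝ)| ≤ 1 := Literature.NumberTheory.LFunctions.abs_moebius_real_le_one r
    rw [abs_mul]
    calc |(μ r : ℝ)| * |I r| ≤ 1 * (((e ^ 2 * r ^ 2 : ℕ) : ℝ) * B) :=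
          mul_le_mul hμ hIle (abs_nonneg _) zero_le_one
      _ = ((e ^ 2 * r ^ 2 : ℕ) : ℝ) * B := one_mul _
      _ ≤ ((e ^ 2 * R ^ 2 : ℕ) : ℝ) * B :=
          mul_le_mul_of_nonneg_right (by exact_mod_cast hQle) hB0
      _ = (e : ℝ) ^ 2 * (R : ℝ) ^ 2 * B := by push_cast; ring
  -- (2) larger `r`: the trivial bound by the count of `r² ∣ n² + 1`
  have htriv : ∀ r : ℕ, |(μ r : ℝ) * I r| ≤ cnt r := by
    intro r
    have hμ : |(μ r : ℝ)| ≤ 1 := Literature.NumberTheory.LFunctions.abs_moebius_real_le_one r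
    have hI1 : |I r| ≤ cnt r := by
      refine (Finset.abs_sum_le_sum_abs _ _).trans ?_
      have hpt : ∀ n ∈ Finset.Icc 1 y,
          |W r n * lam n| ≤ if r ^ 2 ∣ n ^ 2 + 1 then (1 : ℝ) else 0 := by
        intro n _
        simp only [hW, hlam]
        by_cases h : e * r ^ 2 ∣ n ^ 2 + 1
        · rw [if_pos h, if_pos (dvd_trans (dvd_mul_left _ e) h), abs_mul, abs_pow, abs_pow,
            abs_neg, abs_one, one_pow, one_pow, one_mul]
        · rw [if_neg h, zero_mul, abs_zero]
          split_ifs <;> norm_num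
      refine (Finset.sum_le_sum hpt).trans (le_of_eq ?_)
      rw [Finset.sum_boole]
    rw [abs_mul]
    calc |(μ r : ℝ)| * |I r| ≤ 1 * cnt r := mul_le_mul hμ hI1 (abs_nonneg _) zero_le_one
      _ = cnt r := one_mul _
  -- (2a) middle range
  set T := (Finset.Icc 1 Nb).filter (fun r : ℕ => ¬ r ≤ R) with hT
  set T₁ := T.filter (fun r : ℕ => (r : ℝ) ≤ Z) with hT₁
  set T₂ := T.filter (fun r : ℕ => ¬ (r : ℝ) ≤ Z) with hT₂
  have hmid : ∑ r ∈ T₁, cnt r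
      ≤ C₂ * ((y : ℝ) + 1) * (2 / Real.sqrt R) + Z * (C₂ * Real.sqrt Z) := by
    have hpt : ∀ r ∈ T₁, cnt r
        ≤ C₂ * ((y : ℝ) + 1) * (1 / ((r : ℝ) * Real.sqrt r)) + C₂ * Real.sqrt Z := by
      intro r hr
      simp only [hT₁, hT, Finset.mem_filter, Finset.mem_Icc] at hr
      obtain ⟨⟨⟨hr1, -⟩, -⟩, hrZ⟩ := hr
      have hr0 : (0 : ℝ) < r := by exact_mod_cast hr1
      have hsq : Real.sqrt r / (r : ℝ) ^ 2 = 1 / ((r : ℝ) * Real.sqrt r) := by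
        have hs0 : 0 < Real.sqrt r := Real.sqrt_pos.mpr hr0
        have hss : Real.sqrt r * Real.sqrt r = r := Real.mul_self_sqrt hr0.le
        rw [div_eq_div_iff (by positivity) (by positivity)]
        nlinarith
      have hsZ : Real.sqrt r ≤ Real.sqrt Z := Real.sqrt_le_sqrt hrZ
      calc cnt r ≤ C₂ * Real.sqrt r * (((y : ℝ) + 1) / (r : ℝ) ^ 2 + 1) := hC₂ r hr1 y
        _ = C₂ * ((y : ℝ) + 1) * (Real.sqrt r / (r : ℝ) ^ 2) + C₂ * Real.sqrt r := by ring
        _ ≤ C₂ * ((y : ℝ) + 1) * (1 / ((r : ℝ) * Real.sqrt r)) + C₂ * Real.sqrt Z := by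
            rw [hsq]
            gcongr
    refine (Finset.sum_le_sum hpt).trans ?_
    rw [Finset.sum_add_distrib, ← Finset.mul_sum, Finset.sum_const, nsmul_eq_mul]
    have hT₁sub : T₁ ⊆ Finset.Ioc R Nb := by
      intro r hr
      simp only [hT₁, hT, Finset.mem_filter, Finset.mem_Icc] at hr
      rw [Finset.mem_Ioc]
      exact ⟨by omega, hr.1.1.2⟩
    have hsum : ∑ r ∈ T₁, 1 / ((r : ℝ) * Real.sqrt r) ≤ 2 / Real.sqrt R := by
      refine le_trans ?_ (htail R hR Nb)
      exact Finset.sum_le_sum_of_subset_of_nonneg hT₁sub (fun r _ _ => by positivity)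
    have hcard : (T₁.card : ℝ) ≤ Z := by
      have hsub : T₁ ⊆ Finset.Icc 1 ⌊Z⌋₊ := by
        intro r hr
        simp only [hT₁, hT, Finset.mem_filter, Finset.mem_Icc] at hr
        rw [Finset.mem_Icc]
        exact ⟨hr.1.1.1, Nat.le_floor hr.2⟩
      calc (T₁.card : ℝ) ≤ ((Finset.Icc 1 ⌊Z⌋₊).card : ℝ) := by
            exact_mod_cast Finset.card_le_card hsub
        _ = ⌊Z⌋₊ := by rw [Nat.card_Icc]; push_cast; ring
        _ ≤ Z := Nat.floor_le (by linarith)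
    have h1 : C₂ * ((y : ℝ) + 1) * ∑ r ∈ T₁, 1 / ((r : ℝ) * Real.sqrt r)
        ≤ C₂ * ((y : ℝ) + 1) * (2 / Real.sqrt R) :=
      mul_le_mul_of_nonneg_left hsum (by positivity)
    have h2 : (T₁.card : ℝ) * (C₂ * Real.sqrt Z) ≤ Z * (C₂ * Real.sqrt Z) :=
      mul_le_mul_of_nonneg_right hcard (by positivity)
    linarith
  -- (2b) large range
  have hlarge : ∑ r ∈ T₂, cnt r ≤ ((y : ℝ) ^ 2 + 1) / Z ^ 2 * (Nat.log 3 y + 1) := by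
    refine hlarge y Z (by linarith) T₂ (fun r hr => ?_)
    simp only [hT₂, Finset.mem_filter] at hr
    exact lt_of_not_ge hr.2
  -- assemble
  rw [hid]
  refine (Finset.abs_sum_le_sum_abs _ _).trans ?_
  rw [← Finset.sum_filter_add_sum_filter_not (Finset.Icc 1 Nb) (fun r : ℕ => r ≤ R)]
  have hpart1 : ∑ r ∈ (Finset.Icc 1 Nb).filter (fun r : ℕ => r ≤ R), |(μ r : ℝ) * I r|
      ≤ (R : ℝ) * ((e : ℝ) ^ 2 * (R : ℝ) ^ 2 * B) := by
    refine (Finset.sum_le_sum hsmall).trans ?_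
    rw [Finset.sum_const, nsmul_eq_mul]
    have hcard : (((Finset.Icc 1 Nb).filter (fun r : ℕ => r ≤ R)).card : ℝ) ≤ R := by
      have hsub : (Finset.Icc 1 Nb).filter (fun r : ℕ => r ≤ R) ⊆ Finset.Icc 1 R := by
        intro r hr
        rw [Finset.mem_filter, Finset.mem_Icc] at hr
        rw [Finset.mem_Icc]
        exact ⟨hr.1.1, hr.2⟩
      calc (((Finset.Icc 1 Nb).filter (fun r : ℕ => r ≤ R)).card : ℝ)
          ≤ ((Finset.Icc 1 R).card : ℝ) := by exact_mod_cast Finset.card_le_card hsub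
        _ = R := by rw [Nat.card_Icc]; push_cast; ring
    have hB0 : 0 ≤ (e : ℝ) ^ 2 * (R : ℝ) ^ 2 * B := by
      have : 0 ≤ B := (abs_nonneg _).trans (hB 1 le_rfl (Nat.one_le_iff_ne_zero.mpr (by positivity)) 0)
      positivity
    exact mul_le_mul_of_nonneg_right hcard hB0
  have hpart2 : ∑ r ∈ T, |(μ r : ℝ) * I r|
      ≤ C₂ * ((y : ℝ) + 1) * (2 / Real.sqrt R) + Z * (C₂ * Real.sqrt Z)
        + ((y : ℝ) ^ 2 + 1) / Z ^ 2 * (Nat.log 3 y + 1) := by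
    calc ∑ r ∈ T, |(μ r : ℝ) * I r| ≤ ∑ r ∈ T, cnt r := Finset.sum_le_sum (fun r _ => htriv r)
      _ = ∑ r ∈ T₁, cnt r + ∑ r ∈ T₂, cnt r :=
          (Finset.sum_filter_add_sum_filter_not T (fun r : ℕ => (r : ℝ) ≤ Z) cnt).symm
      _ ≤ _ := by linarith [hmid, hlarge]
  linarith [hpart1, hpart2]

end Summit.Parity.BatemanHorn.Theorems.SliceFrame
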